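import Summits.BirchSwinnertonDyer.BirchSwinnertonDyer.Theorems.ByReductionTypeAtTwoAdditivePotGoodLowerHalfT0NarrowRankLayerBoundsDoor
import Literature.NumberTheory.IwasawaTheory.ZpExtensionLayerRamifiedPrimesBound
import Literature.NumberTheory.NumberFields.QuadraticExtensionOddClassNumberNonNormUnit
import Literature.NumberTheory.NumberFields.SqrtGeneratorUnramified
import Literature.NumberTheory.EllipticCurves.CyclotomicZpExtensionLayerGeneratorProofs
import HarnessLib

/-!
# K4 crux `AdditiveRankZeroAtTwo` (19098), children C3″ (22617) / C1″ (22615): AT MOST TWO DYADIC PRIMES in every concrete layer `A_m = ℚ(θ) ⊔ ℚ_m` of the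
# cyclotomic `ℤ₂`-tower of a cubic point field with Fukuda index `0` and two primes above `2` — the prime count of the PARITY STEP of the narrow rank
# certificate, WITHOUT prime elements (KERNEL, any `m`; seat `bsd-2adic-k4-w2` GEN 15; `--supports stmt-BirchSwinnertonDyer-22617 --as helper`)

Cell `bsd-2adic`.  THEOREMS ONLY (no definition, no named fact, no `sorry`).  This is k4-w1 GEN 11's `odd_classNumber_adjoin_sup_layer_two_d316`
(`…NarrowRankCertificate316LayerTwoParity`, the step `m = 1` for ONE cubic with explicit dyadic prime elements of `A₁`) made GENERIC in the cubic and in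
the rung `m`: the count «at most two primes of `A_m` above `2`» is obtained WITHOUT prime elements, from Fukuda's index `n₀ = 0` of the cubic field
(k4-w1/k4-w2 `forall_totallyRamifiedFrom_zero_h<L>`) and «at most two primes of `ℚ(θ)` above `2`» (k4-w1 `ncard_primes_above_two_le_two`), through the
abstract layers of the restricted cyclotomic `ℤ₂`-extension (`ncard_primesOver_two_layer_le`: a dyadic prime of `K_n`, `n ≥ 2`, is TOTALLY ramified over the
cubic `K` — `2ⁿ ∣ e(Q|2) = e(w|2)·e(Q|w)` with `e(w|2) ≤ 3` forces `e(Q|w) ≠ 1`, and the inertia dichotomy at index `0` makes it `[K_n:K]` — hence determined by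
its contraction) and transport along `K_n ≅ A_n` (`ncard_primesOver_two_le_of_ringEquiv`) and up the inclusion `A_m ⊆ A_{m+1}` (`ncard_primesOver_two_le_of_algebra`).
With its sequel it discharges the displayed parities `hK` (with `m = 1` and k4-w1's sextic non-norm units `exists_unit_forall_sq_sub_mul_sq_ne_d<D>`) and `hL` (with `m = 2` and a
degree-`12` non-norm unit) of GEN 15's `conjA_two_<L>_of_layerBounds₂₃`.

* §1 `exists_mul_eq_two_of_iterate_eq_zero` — `Ψ_m(t) = 0`, `m ≥ 1` ⟹ `(2 + t)·w = 2` for some `w` (`Ψ_m = (X + 2)·Q + 2`): a prime containing `2 + t_m`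
  contains `2`.
* §2 `ncard_primesOver_two_le_of_algebra`, `ncard_primesOver_two_le_of_ringEquiv` — the number of dyadic primes does not drop up an extension / along an
  isomorphism of number fields; ★ `ncard_primesOver_two_layer_le` — for a cubic `K`, a cyclotomic `κ` with `TotallyRamifiedFrom κ 0` and `n ≥ 2`:
  `#{Q ⊂ 𝓞 K_n : 2 ∈ Q} ≤ #{w ⊂ 𝓞 K : 2 ∈ w}`; `ncard_primesOver_two_sup_layer_le_two` — `#{v ⊂ 𝓞 A_m : 2 ∈ v} ≤ 2` for every `m`.
* (sequel `…NarrowRankLayerParityStep`: the parity step `h(A_m)` odd + one non-norm unit ⟹ `h(A_{m+1})` odd.)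

HONEST FRAMING (D-0036 / D-0054 / D-0152): theorems about number fields; nothing is asserted about any curve; closes nothing at the `∀`-level (C3″ 22617 / C1″ 22615
research-open); nothing booked; BSD is not proved by any of this.

References: [Lang1990] Ch. 13 §4 Lemma 4.1; [Gras2003] IV.4; [Washington1997] §13.1 Prop. 13.2, Lemma 13.3; [Fukuda1994] p. 264; [NeukirchANT1999] Ch. I §8–§9,
Ch. III §2; [Omeara1963] §63B (63:10).
-/

set_option autoImplicit false
-- sibling precedent (`…NarrowRankLayerBoundsDoor.lean`): the directory name repeats the summit name
set_option linter.dupNamespace false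

noncomputable section

open scoped Classical IntermediateField NumberField Polynomial

namespace Summit.BirchSwinnertonDyer.BirchSwinnertonDyer.Theorems.AddKatoTwo

open Polynomial IsDedekindDomain NumberField Field IntermediateField Ideal
  Literature.NumberTheory.EllipticCurves Literature.NumberTheory.EllipticCurves.ZpExtension
  Literature.NumberTheory.IwasawaTheory Literature.NumberTheory.NumberFields
  Literature.NumberTheory.NumberFields.ClassGroupNormKernel
  Literature.NumberTheory.GaloisRepresentations Literature.Geometry.Kaehler.ComplexTorus

/-! ## §1 A prime containing `2 + t_m` contains `2` -/

/-- **`Ψ_m(−2) = 2` for `m ≥ 1`** (`Ψ_1(−2) = 2` and `2` is a fixed point of `x ↦ x² − 2`). [folklore] -/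
theorem iterate_sq_sub_two_neg_two {R : Type*} [CommRing R] (m : ℕ) (hm : 1 ≤ m) :
    (fun x : R => x ^ 2 - 2)^[m] (-2) = 2 := by
  obtain ⟨k, rfl⟩ := Nat.exists_eq_add_of_le' hm
  rw [Function.iterate_succ_apply]
  have h2 : (fun x : R => x ^ 2 - 2) 2 = 2 := by norm_num
  have : (-2 : R) ^ 2 - 2 = 2 := by norm_num
  rw [this]
  exact Function.iterate_fixed (f := fun x : R => x ^ 2 - 2) h2 k

/-- **If `Ψ_m(t) = 0` with `m ≥ 1` then `(2 + t)·w = 2` for some `w`** (polynomial division `Ψ_m = (X + 2)·Q + Ψ_m(−2)`, `Ψ_m(−2) = 2`); so every prime ideal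
containing `2 + t` contains `2`. [folklore] -/
theorem exists_mul_eq_two_of_iterate_eq_zero {R : Type*} [CommRing R] {t : R} {m : ℕ} (hm : 1 ≤ m)
    (ht : (fun x : R => x ^ 2 - 2)^[m] t = 0) : ∃ w : R, (2 + t) * w = 2 := by
  set P : ℤ[X] := ((X ^ 2 - C 2 : ℤ[X]).comp)^[m] X with hP
  have hdiv : P %ₘ (X - C (-2 : ℤ)) + (X - C (-2 : ℤ)) * (P /ₘ (X - C (-2 : ℤ))) = P :=
    Polynomial.modByMonic_add_div P (X - C (-2 : ℤ))
  rw [Polynomial.modByMonic_X_sub_C_eq_C_eval] at hdiv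
  have heval : P.eval (-2 : ℤ) = 2 := by
    rw [hP, NestedSqrtTwo.eval_eq_iterate]; exact iterate_sq_sub_two_neg_two m hm
  rw [heval] at hdiv
  have hPt : aeval t P = 0 := by rw [hP, NestedSqrtTwo.aeval_eq_iterate]; exact ht
  have h := congrArg (fun f : ℤ[X] => aeval t f) hdiv
  simp only [map_add, map_mul, map_sub, aeval_C, aeval_X, hPt, algebraMap_int_eq, Int.coe_castRingHom,
    Int.cast_ofNat, Int.cast_neg] at h
  refine ⟨-(aeval t (P /ₘ (X - C (-2 : ℤ)))), ?_⟩
  linear_combination (-1 : R) * h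

/-! ## §2 Counting dyadic primes: up an extension, along an isomorphism, and in the layers of the cubic tower -/

section Count

/-- **The number of primes above `2` does not drop in an extension of number fields**: every dyadic prime of `M` lies under a dyadic prime of `L`
(going up for the integral extension `𝓞 M ⊆ 𝓞 L`), and the prime below is determined by the prime above. [cite: NeukirchANT1999, Ch. I §8 (primes above)] -/
theorem ncard_primesOver_two_le_of_algebra (M L : Type) [Field M] [NumberField M] [Field L] [NumberField L] [Algebra M L] :
    {v : HeightOneSpectrum (𝓞 M) | ((2 : ℕ) : 𝓞 M) ∈ v.asIdeal}.ncard ≤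
      {W : HeightOneSpectrum (𝓞 L) | ((2 : ℕ) : 𝓞 L) ∈ W.asIdeal}.ncard := by
  classical
  -- the target set is finite
  have h20 : (Ideal.span {((2 : ℕ) : 𝓞 L)} : Ideal (𝓞 L)) ≠ ⊥ := by
    rw [Ne, Ideal.span_singleton_eq_bot, Nat.cast_ofNat]; exact two_ne_zero
  have hTfin : {W : HeightOneSpectrum (𝓞 L) | ((2 : ℕ) : 𝓞 L) ∈ W.asIdeal}.Finite := by
    refine (Ideal.finite_factors h20).subset fun W hW => ?_
    exact (Ideal.dvd_span_singleton).mpr hW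
  -- choose a prime above each dyadic prime
  have hex : ∀ v : HeightOneSpectrum (𝓞 M), ∃ W : HeightOneSpectrum (𝓞 L), W.asIdeal.LiesOver v.asIdeal := by
    intro v
    haveI := v.isMaximal
    obtain ⟨Q, hQmax, hQover⟩ := Ideal.exists_maximal_ideal_liesOver_of_isIntegral (S := 𝓞 L) v.asIdeal
    exact ⟨⟨Q, hQmax.isPrime, Ring.ne_bot_of_isMaximal_of_not_isField hQmax (RingOfIntegers.not_isField L)⟩, hQover⟩
  choose g hg using hex
  have hmaps : Set.MapsTo g {v | ((2 : ℕ) : 𝓞 M) ∈ v.asIdeal} {W | ((2 : ℕ) : 𝓞 L) ∈ W.asIdeal} := by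
    intro v hv
    have hover := (hg v).over
    show ((2 : ℕ) : 𝓞 L) ∈ (g v).asIdeal
    have : algebraMap (𝓞 M) (𝓞 L) ((2 : ℕ) : 𝓞 M) ∈ (g v).asIdeal := by
      rw [← Ideal.mem_comap, ← Ideal.under_def, ← hover]; exact hv
    rwa [map_natCast] at this
  have hinj : Set.InjOn g {v | ((2 : ℕ) : 𝓞 M) ∈ v.asIdeal} := by
    intro v _ v' _ hvv
    apply HeightOneSpectrum.ext
    rw [(hg v).over, (hg v').over, hvv]
  exact Set.ncard_le_ncard_of_injOn g hmaps hinj hTfin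

/-- **The number of primes above `2` is invariant along an isomorphism of number fields** (one inequality; apply to `e.symm` for the other).
[cite: NeukirchANT1999, Ch. I §8] -/
theorem ncard_primesOver_two_le_of_ringEquiv {M L : Type} [Field M] [NumberField M] [Field L] [NumberField L] (e : M ≃+* L) :
    {v : HeightOneSpectrum (𝓞 M) | ((2 : ℕ) : 𝓞 M) ∈ v.asIdeal}.ncard ≤
      {W : HeightOneSpectrum (𝓞 L) | ((2 : ℕ) : 𝓞 L) ∈ W.asIdeal}.ncard := by
  letI : Algebra M L := e.toRingHom.toAlgebra
  haveI : Module.Finite M L := by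
    refine Module.Finite.of_surjective (Algebra.linearMap M L) ?_
    intro y; exact ⟨e.symm y, by simp [Algebra.linearMap_apply, RingHom.algebraMap_toAlgebra]⟩
  exact ncard_primesOver_two_le_of_algebra M L

variable {K : Type} [Field K] [NumberField K]

set_option maxHeartbeats 800000 in
/-- ★ **Dyadic primes of a layer `K_n`, `n ≥ 2`, of a cyclotomic `ℤ₂`-extension of a CUBIC field with Fukuda index `0` inject into the dyadic primes of `K`**:
`#{Q ⊂ 𝓞 K_n : 2 ∈ Q} ≤ #{w ⊂ 𝓞 K : 2 ∈ w}`.  For `Q ∣ w ∣ 2`: `2ⁿ ∣ e(Q|2) = e(w|2)·e(Q|w)` (a root of `Ψ_n` lies in `K_n`,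
`pow_dvd_ramificationIdx_int_of_iterate_root`) with `e(w|2) ≤ [K:ℚ] = 3 < 4 ≤ 2ⁿ`, so `e(Q|w) ≠ 1`; by the inertia dichotomy at index `0`
(`inertia_layer_eq_bot_or_forall_mem`) `Q` is totally ramified over `K`, `e(Q|K) = [K_n : K]`, hence it is the only prime of `K_n` above `w`
(`eq_of_under_eq_of_ramificationIdx_eq_finrank`). [cite: Washington1997, §13.1 Prop. 13.2 and Lemma 13.3] [cite: Fukuda1994, p. 264 (the index `n₀`)]
[cite: NeukirchANT1999, Ch. I §9 Prop. (9.1)] -/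
theorem ncard_primesOver_two_layer_le (h3 : Module.finrank ℚ K = 3) (κ : ZpExtension K 2) (hcyc : κ.IsCyclotomic)
    (hκ : TotallyRamifiedFrom κ 0) (n : ℕ) (hn : 2 ≤ n) [NumberField (κ.layer n)] :
    {Q : HeightOneSpectrum (𝓞 (κ.layer n)) | ((2 : ℕ) : 𝓞 (κ.layer n)) ∈ Q.asIdeal}.ncard ≤
      {w : HeightOneSpectrum (𝓞 K) | ((2 : ℕ) : 𝓞 K) ∈ w.asIdeal}.ncard := by
  classical
  haveI : Fact (Nat.Prime 2) := ⟨Nat.prime_two⟩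
  set L := κ.layer n
  haveI : FiniteDimensional K L := κ.finiteDimensional_layer_holds _
  haveI : IsGalois K L := κ.isGalois_layer_holds _
  have hK2 : ¬ 2 ∣ Module.finrank ℚ K := by rw [h3]; norm_num
  obtain ⟨θ, hθ⟩ := exists_iterate_root_layer_of_not_dvd_finrank hK2 κ hcyc n
  -- the target set is finite
  have h20 : (Ideal.span {((2 : ℕ) : 𝓞 K)} : Ideal (𝓞 K)) ≠ ⊥ := by
    rw [Ne, Ideal.span_singleton_eq_bot, Nat.cast_ofNat]; exact two_ne_zero
  have hTfin : {w : HeightOneSpectrum (𝓞 K) | ((2 : ℕ) : 𝓞 K) ∈ w.asIdeal}.Finite := by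
    refine (Ideal.finite_factors h20).subset fun w hw => ?_
    exact (Ideal.dvd_span_singleton).mpr hw
  -- the contraction map
  have hunder0 : ∀ Q : HeightOneSpectrum (𝓞 L), Q.asIdeal.under (𝓞 K) ≠ ⊥ := fun Q =>
    mt Ideal.eq_bot_of_comap_eq_bot Q.ne_bot
  let f : HeightOneSpectrum (𝓞 L) → HeightOneSpectrum (𝓞 K) := fun Q =>
    ⟨Q.asIdeal.under (𝓞 K), Ideal.IsPrime.under (𝓞 K) Q.asIdeal, hunder0 Q⟩
  -- KEY: a dyadic `Q` is totally ramified over `K`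
  have key : ∀ Q : HeightOneSpectrum (𝓞 L), ((2 : ℕ) : 𝓞 L) ∈ Q.asIdeal →
      Q.asIdeal.ramificationIdx (𝓞 K) = Module.finrank K L := by
    intro Q hQ2
    haveI : Q.asIdeal.IsMaximal := Q.isMaximal
    set w : Ideal (𝓞 K) := Q.asIdeal.under (𝓞 K) with hw
    haveI : Q.asIdeal.LiesOver w := ⟨rfl⟩
    haveI : w.IsMaximal := Ideal.IsMaximal.under (𝓞 K) Q.asIdeal
    have hw2 : ((2 : ℕ) : 𝓞 K) ∈ w := by
      rw [hw, Ideal.under_def, Ideal.mem_comap, map_natCast]; exact hQ2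
    have hwbot : w ≠ ⊥ := hunder0 Q
    set wv : HeightOneSpectrum (𝓞 K) := ⟨w, Ideal.IsMaximal.isPrime inferInstance, hwbot⟩ with hwv
    -- `2ⁿ ∣ e(Q|2) = e(w|2) e(Q|w)`, `e(w|2) ≤ 3`
    haveI : Q.asIdeal.LiesOver (Ideal.span {(2 : ℤ)}) := by
      rw [Ideal.liesOver_span_iff Q.isPrime.ne_top Int.prime_two, map_ofNat]; exact_mod_cast hQ2
    haveI : w.LiesOver (Ideal.span {(2 : ℤ)}) := by
      rw [Ideal.liesOver_span_iff (Ideal.IsMaximal.isPrime inferInstance).ne_top Int.prime_two, map_ofNat]; exact_mod_cast hw2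
    have hdvd := pow_dvd_ramificationIdx_int_of_iterate_root hθ Q.asIdeal
    rw [Ideal.ramificationIdx_tower w Q.asIdeal] at hdvd
    have hle : w.ramificationIdx ℤ ≤ Module.finrank ℚ K := ramificationIdx_int_le_finrank (K := K) (w := wv) hw2
    have hpos : 0 < w.ramificationIdx ℤ := Ideal.ramificationIdx_pos w ℤ
    have hne1 : Q.asIdeal.ramificationIdx (𝓞 K) ≠ 1 := by
      intro h1
      rw [h1, mul_one] at hdvd
      have h4 : 4 ∣ 2 ^ n := by
        obtain ⟨k, rfl⟩ := Nat.exists_eq_add_of_le' hn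
        exact ⟨2 ^ k, by ring⟩
      have := Nat.le_of_dvd hpos (h4.trans hdvd)
      omega
    -- inertia dichotomy at index `0`
    have hcard := Ideal.card_inertia_eq_ramificationIdxIn (G := L ≃ₐ[K] L) w Q.asIdeal
    rw [Ideal.ramificationIdxIn_eq_ramificationIdx w Q.asIdeal (L ≃ₐ[K] L)] at hcard
    rcases κ.inertia_layer_eq_bot_or_forall_mem hκ (n := 0) (m := n) le_rfl (Nat.zero_le _) Q.asIdeal with h1 | h2
    · rw [h1, Subgroup.card_bot] at hcard
      exact absurd hcard.symm hne1
    · have htop : Q.asIdeal.inertia (L ≃ₐ[K] L) = ⊤ := by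
        refine top_le_iff.mp fun g _ => h2 g fun x hx => ?_
        rw [κ.layer_zero, IntermediateField.mem_bot] at hx
        obtain ⟨k, hk⟩ := hx
        have hx' : x = algebraMap K L k := Subtype.ext hk.symm
        rw [hx', AlgEquiv.commutes]
      rw [htop, Subgroup.card_top, Nat.card_eq_fintype_card, ← Nat.card_eq_fintype_card, IsGalois.card_aut_eq_finrank] at hcard
      exact hcard.symm
  -- maps into the target
  have hmaps : Set.MapsTo f {Q | ((2 : ℕ) : 𝓞 L) ∈ Q.asIdeal} {w | ((2 : ℕ) : 𝓞 K) ∈ w.asIdeal} := by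
    intro Q hQ
    show ((2 : ℕ) : 𝓞 K) ∈ Q.asIdeal.under (𝓞 K)
    rw [Ideal.under_def, Ideal.mem_comap, map_natCast]; exact hQ
  -- injective on the dyadic primes
  have hinj : Set.InjOn f {Q | ((2 : ℕ) : 𝓞 L) ∈ Q.asIdeal} := by
    intro Q hQ Q' hQ' hfQ
    haveI : Q.asIdeal.IsMaximal := Q.isMaximal
    haveI : Q'.asIdeal.IsMaximal := Q'.isMaximal
    have hw : Q'.asIdeal.under (𝓞 K) = Q.asIdeal.under (𝓞 K) := by
      have := congrArg HeightOneSpectrum.asIdeal hfQ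
      exact this.symm
    apply HeightOneSpectrum.ext
    exact (eq_of_under_eq_of_ramificationIdx_eq_finrank (B := K) (F := L) Q.asIdeal (key Q hQ) Q'.asIdeal hw).symm
  exact Set.ncard_le_ncard_of_injOn f hmaps hinj hTfin

end Count

/-! ## §3 Dyadic primes of the concrete layers `A_m = ℚ(θ) ⊔ ℚ_m` of a totally real cubic field -/

section Layers

variable {p q r : ℤ} {θ : AlgebraicClosure ℚ}

set_option maxHeartbeats 800000 in
/-- **At most two primes of `A_m = ℚ(θ) ⊔ ℚ_m` above `2`** (any `m`), for a cubic field `ℚ(θ)` with Fukuda index `0` along every cyclotomic `ℤ₂`-extension and at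
most two primes above `2`: `#{v ⊂ 𝓞 A_m : 2 ∈ v} ≤ #{dyadic primes of A_{m+2}} = #{dyadic primes of K_{m+2}}` (restricted cyclotomic tower, `K_{m+2} ≅ A_{m+2}`)
`≤ #{dyadic primes of ℚ(θ)} ≤ 2`. [cite: Washington1997, §13.1 Prop. 13.2 and Lemma 13.3] [cite: Fukuda1994, p. 264] -/
theorem ncard_primesOver_two_sup_layer_le_two (hirr : Irreducible (Cubic.toPoly ⟨1, (p : ℚ), q, r⟩))
    (hθ : aeval θ (Cubic.toPoly ⟨1, (p : ℚ), q, r⟩) = 0)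
    (hn0 : haveI : FiniteDimensional ℚ ↥ℚ⟮θ⟯ :=
        IntermediateField.adjoin.finiteDimensional ⟨_, Cubic.monic_of_a_eq_one', by rwa [← aeval_def]⟩
      haveI : NumberField ↥ℚ⟮θ⟯ := NumberField.mk
      ∀ κL : ZpExtension ↥ℚ⟮θ⟯ 2, κL.IsCyclotomic → TotallyRamifiedFrom κL 0)
    (h2 : haveI : FiniteDimensional ℚ ↥ℚ⟮θ⟯ :=
        IntermediateField.adjoin.finiteDimensional ⟨_, Cubic.monic_of_a_eq_one', by rwa [← aeval_def]⟩
      haveI : NumberField ↥ℚ⟮θ⟯ := NumberField.mk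
      {w : HeightOneSpectrum (𝓞 ↥ℚ⟮θ⟯) | ((2 : ℕ) : 𝓞 ↥ℚ⟮θ⟯) ∈ w.asIdeal}.ncard ≤ 2)
    (m : ℕ) :
    haveI : FiniteDimensional ℚ ↥ℚ⟮θ⟯ :=
      IntermediateField.adjoin.finiteDimensional ⟨_, Cubic.monic_of_a_eq_one', by rwa [← aeval_def]⟩
    haveI : FiniteDimensional ℚ ↥((CyclotomicZp.zpExtension 2).layer m) := (CyclotomicZp.zpExtension 2).finiteDimensional_layer_holds m
    haveI : NumberField ↥(ℚ⟮θ⟯ ⊔ (CyclotomicZp.zpExtension 2).layer m) := NumberField.mk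
    {v : HeightOneSpectrum (𝓞 ↥(ℚ⟮θ⟯ ⊔ (CyclotomicZp.zpExtension 2).layer m)) |
      ((2 : ℕ) : 𝓞 ↥(ℚ⟮θ⟯ ⊔ (CyclotomicZp.zpExtension 2).layer m)) ∈ v.asIdeal}.ncard ≤ 2 := by
  haveI : Fact (Nat.Prime 2) := ⟨Nat.prime_two⟩
  haveI : FiniteDimensional ℚ ↥ℚ⟮θ⟯ :=
    IntermediateField.adjoin.finiteDimensional ⟨_, Cubic.monic_of_a_eq_one', by rwa [← aeval_def]⟩
  haveI : FiniteDimensional ℚ ↥((CyclotomicZp.zpExtension 2).layer m) := (CyclotomicZp.zpExtension 2).finiteDimensional_layer_holds m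
  haveI : FiniteDimensional ℚ ↥((CyclotomicZp.zpExtension 2).layer (m + 2)) :=
    (CyclotomicZp.zpExtension 2).finiteDimensional_layer_holds (m + 2)
  haveI : NumberField ↥ℚ⟮θ⟯ := NumberField.mk
  haveI : NumberField ↥(ℚ⟮θ⟯ ⊔ (CyclotomicZp.zpExtension 2).layer m) := NumberField.mk
  haveI : NumberField ↥(ℚ⟮θ⟯ ⊔ (CyclotomicZp.zpExtension 2).layer (m + 2)) := NumberField.mk
  set κ := CyclotomicZp.zpExtension 2 with hκdef
  have h3 : Module.finrank ℚ ↥ℚ⟮θ⟯ = 3 := finrank_adjoin_eq_three_of_irreducible hirr hθ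
  have hodd3 : Odd (Module.finrank ℚ ↥ℚ⟮θ⟯) := by rw [h3]; decide
  have hsurj := surjective_comp_absGaloisRestrict_cyclotomicZp_of_odd ℚ⟮θ⟯ hodd3
  set κE := κ.restrict ↥ℚ⟮θ⟯ hsurj with hκE
  haveI : FiniteDimensional ↥ℚ⟮θ⟯ (κE.layer (m + 2)) := κE.finiteDimensional_layer_holds (m + 2)
  haveI : NumberField (κE.layer (m + 2)) := NumberField.of_module_finite ↥ℚ⟮θ⟯ _
  obtain ⟨f⟩ := nonempty_algEquiv_layer_restrict_fieldRange_sup_layer κ ↥ℚ⟮θ⟯ hsurj (ℚ⟮θ⟯).val (m + 2)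
  have hrange : (ℚ⟮θ⟯).val.fieldRange ⊔ κ.layer (m + 2) = ℚ⟮θ⟯ ⊔ κ.layer (m + 2) := by rw [fieldRange_val]
  set e : ↥(κE.layer (m + 2)) ≃ₐ[ℚ] ↥(ℚ⟮θ⟯ ⊔ κ.layer (m + 2)) := f.trans (equivOfEq hrange) with hedef
  have hcyc : κE.IsCyclotomic := ZpExtension.isCyclotomic_restrict κ (CyclotomicZp.isCyclotomic_zpExtension 2) ↥ℚ⟮θ⟯ hsurj
  -- `A_m ⊆ A_{m+2}`
  have h12 : ℚ⟮θ⟯ ⊔ κ.layer m ≤ ℚ⟮θ⟯ ⊔ κ.layer (m + 2) := sup_le_sup_left (κ.layer_mono (by omega)) _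
  letI : Algebra ↥(ℚ⟮θ⟯ ⊔ κ.layer m) ↥(ℚ⟮θ⟯ ⊔ κ.layer (m + 2)) := (inclusion h12).toRingHom.toAlgebra
  haveI : IsScalarTower ℚ ↥(ℚ⟮θ⟯ ⊔ κ.layer m) ↥(ℚ⟮θ⟯ ⊔ κ.layer (m + 2)) :=
    IsScalarTower.of_algebraMap_eq fun x => ((inclusion h12).commutes x).symm
  haveI : Module.Finite ↥(ℚ⟮θ⟯ ⊔ κ.layer m) ↥(ℚ⟮θ⟯ ⊔ κ.layer (m + 2)) := Module.Finite.of_restrictScalars_finite ℚ _ _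
  calc {v : HeightOneSpectrum (𝓞 ↥(ℚ⟮θ⟯ ⊔ κ.layer m)) | ((2 : ℕ) : 𝓞 ↥(ℚ⟮θ⟯ ⊔ κ.layer m)) ∈ v.asIdeal}.ncard
      ≤ {v : HeightOneSpectrum (𝓞 ↥(ℚ⟮θ⟯ ⊔ κ.layer (m + 2))) | ((2 : ℕ) : 𝓞 ↥(ℚ⟮θ⟯ ⊔ κ.layer (m + 2))) ∈ v.asIdeal}.ncard :=
        ncard_primesOver_two_le_of_algebra _ _
    _ ≤ {v : HeightOneSpectrum (𝓞 ↥(κE.layer (m + 2))) | ((2 : ℕ) : 𝓞 ↥(κE.layer (m + 2))) ∈ v.asIdeal}.ncard :=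
        ncard_primesOver_two_le_of_ringEquiv e.symm.toRingEquiv
    _ ≤ {w : HeightOneSpectrum (𝓞 ↥ℚ⟮θ⟯) | ((2 : ℕ) : 𝓞 ↥ℚ⟮θ⟯) ∈ w.asIdeal}.ncard :=
        ncard_primesOver_two_layer_le h3 κE hcyc (hn0 κE hcyc) (m + 2) (by omega)
    _ ≤ 2 := h2

end Layers

end Summit.BirchSwinnertonDyer.BirchSwinnertonDyer.Theorems.AddKatoTwo

end
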